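import Literature.NumberTheory.LFunctions.KMVMomentAsymptoticsBeyondDiagonal
import HarnessLib

/-!
# Route `PrimeLevelFamEdge` — TYPED IDEA DELTAS, deck 26: `transfer` lens × U-d — K-L12-3 «THE CUSPIDAL-KERNEL TWIN»
# (cell ls-idea, seat `ls-idea-lens-12` gen 3, card K-L12-3 + S-L12-5/5′ + A-L12-3 = HOME/cards/ls-idea-lens-12.md
# d6f06ba05b7efe4d l.103–143; the seat's `SketchL12W3.lean` v3.0a sha16 302de9394f30b62c (155 l.), critics
# A b122 PASS · B b118.3 PASS (BN-7a CONTRAST LINE booked) · C b107 PASS · D b42 PASS + precision P-D42-1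
# (answered by the seat in v3.0a: `KernelAsymptoticWith` / `TwinBeyondDiagonalWith`); LANDING NOTE typer
# ls-idea-typ-1 gen 4: VERBATIM up to (i) namespace `…Sketch.LsIdeaLens12W3` → the deck namespace
# `…Theorems.PrimeLevelFamEdgeIdeaDeltas.CuspTwin`, (ii) this header.)

HONESTY. No exceptional-zero theorem (no Landau–Siegel / Siegel-zero exclusion, no Theorem 1–2 of
arXiv:2211.02515, no repaired Margin232) is proved here or by ideation; typed ≠ proved; located ≠ endorsed.
Everything below is a DEFINITION (a `Prop` schema, never asserted), POSITED DATA with no axiom (`RSKernel`),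
or PROVED bookkeeping (`qhPQ_eq_kernelMoment` definitional; `kernelBeyondDiagonal_of_with`).  DOOR VALUE NIL BY
CONSTRUCTION (card row 10, all four critics): the twin is `D`-blind — it has no character channel — so it says
nothing about `L(1,χ_D)`; its use is a RUNG (BC5-type witness for K4-5's cruxes K1/K3) and a transfer LEDGER whose
one non-identity row names the first non-transferring step twin → door: `S₁` = K4-5 K2 `SmallConductorRootLog`.

DICTIONARY (door ↦ twin; seat's text). Same family `H₂(q)` (`q` prime), same harmonic weights, same KMV Möbius
mollifier `M_P(f)` of length `M = q̂^Δ` (`KMV2000.mollifierP`); only the KERNEL changes: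
`|Λ(f,½)|² ~ L(f ⊗ E, ½)` (coefficients `τ = 1∗1`) ↦ `L(f ⊗ g, ½)` (coefficients `λ_g`, `g` a FIXED
level-one cusp form). After Petersson + Voronoi both off-diagonals are Möbius-autoconvolution × SHIFTED-KERNEL
sums `∑_{n ≤ X} (μP∗μP)(n) K(n + h q)`, `X = M²`, `1 ≤ |h| ≲ (X/q)^{1/2}`; the door's kernel `K = τ` has a
main term in every progression (⇒ small-conductor character sums `S₁`, power saving ⇔ zero-free strips,
log saving ⇔ Siegel–Walfisz: Drappeau–Topacogullari arXiv:1807.09569 Thm 1.1 / p. 5; Assing–Blomer–Li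
arXiv:2005.13915 §4 p. 22), the twin's kernel `K = λ_g` has none (`S₁ = ∅`; ABL Thm 1.3 gives `x^{1−δ}` for
`Λ` unconditionally; Pitt, J. AMS 26 (2013)). FIRST NON-TRANSFERRING STEP (twin → door) = `S₁` = card K4-5's
crux K2 `SmallConductorRootLog`.  Critic B's barrier reading (b118.3): the fixed-level wall BN-7a is carried by
the KERNEL's Eisenstein nature (aligned divisor sums = Θ(1) of the diagonal), not by the Möbius vector; for a
level-one cusp kernel the shifted sums have no main term and power saving — a CONTRAST line, not an evasion.
-/

noncomputable section

open scoped Real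
open scoped ArithmeticFunction.sigma
open CongruenceSubgroup Complex Finset Polynomial
open Literature.NumberTheory.EllipticCurves.ModularForms

namespace Summit.Parity.GeneralizedHardyLittlewood.Theorems.PrimeLevelFamEdgeIdeaDeltas.CuspTwin

open Literature.NumberTheory.LFunctions

/-! ## 1. The arithmetic cores: Möbius-autoconvolution against a shifted kernel -/

/-- `μ ∗ μ` (Dirichlet autoconvolution of the Möbius function = `d_{-2}`, the coefficient shape of the
square of a Möbius mollifier, smooth cut-offs stripped). -/
def moebiusSq : ArithmeticFunction ℤ := ArithmeticFunction.moebius * ArithmeticFunction.moebius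

/-- POWER-saving, shift-uniform bound for `μ∗μ` against the shifted kernel `K`:
`∃ δ > 0: ∑_{n ≤ x} (μ∗μ)(n) K(n + f) ≪ x^{1−δ}` uniformly in `1 ≤ f ≤ x`. -/
def ShiftedPowerSaving (K : ℕ → ℂ) : Prop :=
  ∃ δ : ℝ, 0 < δ ∧ ∃ C x₀ : ℝ, ∀ x : ℝ, x₀ ≤ x → ∀ f : ℕ, 1 ≤ f → (f : ℝ) ≤ x →
    ‖∑ n ∈ Icc 1 ⌊x⌋₊, ((moebiusSq n : ℤ) : ℂ) * K (n + f)‖ ≤ C * x ^ (1 - δ)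

/-- LOG-power-saving version (every `A`): `∑_{n ≤ x} (μ∗μ)(n) K(n + f) ≪_A x (log x)^{−A}`, `1 ≤ f ≤ x`. -/
def ShiftedLogSaving (K : ℕ → ℂ) : Prop :=
  ∀ A : ℝ, ∃ C x₀ : ℝ, ∀ x : ℝ, x₀ ≤ x → ∀ f : ℕ, 1 ≤ f → (f : ℝ) ≤ x →
    ‖∑ n ∈ Icc 1 ⌊x⌋₊, ((moebiusSq n : ℤ) : ℂ) * K (n + f)‖ ≤ C * x * (Real.log x) ^ (-A)

/-- The DOOR's kernel: the divisor function `τ = d = σ₀` (Fourier coefficients of the level-one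
Eisenstein series / of `ζ(s)²`). -/
def divisorKernel : ℕ → ℂ := fun n ↦ ((σ 0 n : ℕ) : ℂ)

/-- The TWIN's kernel: the normalised Hecke eigenvalues `λ_g(n) = a_g(n) n^{−(k−1)/2}` of a fixed cusp form
`g` of level one and weight `k` (for `g = 0` everything below is vacuous-true, harmlessly). -/
def cuspKernel {k : ℤ} (g : CuspForm (Gamma0 1) k) : ℕ → ℂ := fun n ↦ GL2Family.heckeLambda g n

/-- T-L12-3a — the twin's ONLY deep input beyond the diagonal: power saving for `μ∗μ × λ_g(n + f)`,
uniform in `f ≤ x`. In print for `Λ` in place of `μ∗μ` (ABL Thm 1.3, unconditional) and suggested for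
Möbius-type weights by Drappeau–Topacogullari (p. 4, «we do not pursue this here»): COROLLARY-DISTANCE,
not a printed statement. -/
def TwinResidualInput {k : ℤ} (g : CuspForm (Gamma0 1) k) : Prop := ShiftedPowerSaving (cuspKernel g)

/-- T-L12-3b — the door's analogue at a FIXED `Δ' > 1`: power saving for `μ∗μ × τ(n + f)`. By every known
method this is zero-free-STRIP strength for `ζ` and the `L(s,χ)` of conductor `≤ x^δ` (DT p. 5 L11–13;
ABL p. 3: `x^{1−δ}` iff GRH). The first non-transferring step lives here (`S₁`). -/
def DoorResidualInputPower : Prop := ShiftedPowerSaving divisorKernel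

/-- T-L12-3c — the door's input in the SLIVER currency (`Δ' − 1 ≍ log log q / log q`, card K4-5): log-power
saving for `μ∗μ × τ(n + f)`; Siegel–Walfisz strength (print-distance: DT Thm 1.3 with `z = −2` for
`|f| ≤ x^δ`; full shift range = ABL Thm 1.1-type uniformity, corollary-distance), INEFFECTIVE and
exceptional-character-sensitive — K2's home. -/
def DoorResidualInputLog : Prop := ShiftedLogSaving divisorKernel

/-! ## 2. The family side: one kernel-weighted mollified harmonic moment for both doors -/

section Family

variable (q : ℕ) [NeZero q]

/-- `T_V(q; P, M) := ∑ʰ_{f ∈ S₂(q)} V(f) · |M_P(f)|²` — the KMV Möbius mollifier `M_P` of length `M` against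
an arbitrary kernel weight `V`. -/
def kernelMoment (V : CuspForm (Gamma0 q) 2 → ℂ) (P : ℝ[X]) (M : ℝ) : ℂ :=
  GL2Family.harmonicSum q 2 (fun f ↦ V f * (((‖KMV2000.mollifierP q P M f‖ ^ 2 : ℝ)) : ℂ))

/-- Dictionary row 0 (PROVED, definitional): the door's mollified second moment `Q^h(P, Q)` IS the kernel
moment with the Eisenstein-square kernel `V_E(f) = |Q̃(Λ(f,s))(½)|²`. -/
theorem qhPQ_eq_kernelMoment (P Q : ℝ[X]) (M : ℝ) :
    KMV2000.QhPQ q P Q M = kernelMoment q (fun f ↦ (((‖KMV2000.Qtilde q Q f‖ ^ 2 : ℝ)) : ℂ)) P M := by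
  unfold KMV2000.QhPQ kernelMoment
  congr 1
  funext f
  rw [norm_mul, mul_pow]
  push_cast
  ring

end Family

/-- POSITED DATA (definition request D-L12-3; NO axioms, nothing smuggled): a candidate for the central
Rankin–Selberg value `f ↦ L(f ⊗ g, ½)` on `S₂(q)`; the tree has no Rankin–Selberg `L`-function yet, so the
twin's family statement is schematic in this function family. -/
structure RSKernel where
  /-- `val q f`, intended `= L(f ⊗ g, ½)` for `f ∈ S₂(q)`. -/
  val : ∀ (q : ℕ) [NeZero q], CuspForm (Gamma0 q) 2 → ℂ

/-- BEYOND-THE-DIAGONAL ONE-TERM ASYMPTOTIC for a kernel family `V` on the window `(1, Δhi]` at scale `s`: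
for every admissible `P` and `Δ ∈ (1, Δhi]` there is a `q`-FREE leading coefficient `c = c(P, Δ)` with
`T_V(q; P, q̂^Δ) = c · s(q̂) · (1 + O(1/log q̂))` over primes `q → ∞`. (`s` is FIXED by the instance — e.g.
`s_E(t) = t/(log t)²` for the door, where K_A's second half gives `c = 2ζ(2)²(secondMomentForm + T₂)/Δ²`.) -/
def KernelBeyondDiagonal (V : ∀ (q : ℕ) [NeZero q], CuspForm (Gamma0 q) 2 → ℂ) (s : ℝ → ℝ) (Δhi : ℝ) :
    Prop :=
  1 < Δhi ∧ ∀ P : ℝ[X], KMV2000.Admissible P → ∀ Δ : ℝ, 1 < Δ → Δ ≤ Δhi →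
    ∃ c C : ℝ, ∃ q₀ : ℕ, ∀ (q : ℕ) [NeZero q], q.Prime → q₀ ≤ q →
      ‖kernelMoment q (V q) P (KMV2000.qhat q ^ Δ) - ((c * s (KMV2000.qhat q) : ℝ) : ℂ)‖ ≤
        C * |s (KMV2000.qhat q)| * (Real.log (KMV2000.qhat q))⁻¹

/-- T-L12-3 (the twin's family statement, schematic in the RS data and its scale `s_g`): the cuspidal-kernel
twin has a one-term asymptotic on some window `(1, 1 + η]` BEYOND the door's diagonal. The card's law:
`TwinResidualInput g` + standard bookkeeping (AFE, Petersson, Voronoi for `g` to moduli `cq` — no polar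
term —, stationary phase, KMV 2002's `h = 0` term) ⇒ this with `η = 2δ'/(1 − 2δ')`. Not proved here. -/
def TwinBeyondDiagonal (L : RSKernel) (s : ℝ → ℝ) : Prop :=
  ∃ η : ℝ, 0 < η ∧ KernelBeyondDiagonal L.val s (1 + η)

/-- NON-DEGENERATE INSTANCING SHAPE (answer to critic D, P-D42-1: `KernelBeyondDiagonal` is junk-inhabitable —
`V ≡ 0` with `c = 0`, or a fast-growing free `s`, witnesses it): here the scale `s` AND the `q`-free leading
coefficient functional `c : ℝ → ℝ[X] → ℝ` are INPUTS named by the instance (for the twin: `s_g`, `c_g` from the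
residue computation of row S-L12-5′; for the door: `s_E(t) = t/(log t)²`, `c_E = 2ζ(2)²(secondMomentForm + T₂)/Δ²`),
so the statement asserts a SPECIFIC main term, not the existence of one. -/
def KernelAsymptoticWith (V : ∀ (q : ℕ) [NeZero q], CuspForm (Gamma0 q) 2 → ℂ) (s : ℝ → ℝ)
    (c : ℝ → ℝ[X] → ℝ) (Δlo Δhi : ℝ) : Prop :=
  ∀ P : ℝ[X], KMV2000.Admissible P → ∀ Δ : ℝ, Δlo < Δ → Δ ≤ Δhi →
    ∃ C : ℝ, ∃ q₀ : ℕ, ∀ (q : ℕ) [NeZero q], q.Prime → q₀ ≤ q →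
      ‖kernelMoment q (V q) P (KMV2000.qhat q ^ Δ) - ((c Δ P * s (KMV2000.qhat q) : ℝ) : ℂ)‖ ≤
        C * |s (KMV2000.qhat q)| * (Real.log (KMV2000.qhat q))⁻¹

/-- The specific-main-term shape implies the existential one on any window beyond the diagonal (bookkeeping). -/
theorem kernelBeyondDiagonal_of_with {V : ∀ (q : ℕ) [NeZero q], CuspForm (Gamma0 q) 2 → ℂ} {s : ℝ → ℝ}
    {c : ℝ → ℝ[X] → ℝ} {Δhi : ℝ} (hΔ : 1 < Δhi) (h : KernelAsymptoticWith V s c 1 Δhi) :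
    KernelBeyondDiagonal V s Δhi := by
  refine ⟨hΔ, fun P hP Δ h1 h2 ↦ ?_⟩
  obtain ⟨C, q₀, H⟩ := h P hP Δ h1 h2
  exact ⟨c Δ P, C, q₀, fun q _ hq hq₀ ↦ H q hq hq₀⟩

/-- The twin's family statement in instancing shape: scale `s_g` and coefficient functional `c_g` are NAMED
inputs (to be supplied by S-L12-5′), window `(1, 1 + η]`. -/
def TwinBeyondDiagonalWith (L : RSKernel) (s_g : ℝ → ℝ) (c_g : ℝ → ℝ[X] → ℝ) (η : ℝ) : Prop :=
  0 < η ∧ KernelAsymptoticWith L.val s_g c_g 1 (1 + η)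

/-- The door's own version of the same schema (kernel `V_E`, scale `t/(log t)²`), for comparison with
K_A = `PrimeLevelFamEdge.MomentsBeyondDiagonal` (which is finer: polynomial main-term shape + first moment). -/
def DoorBeyondDiagonalSchema : Prop :=
  ∃ η : ℝ, 0 < η ∧ KernelBeyondDiagonal
    (fun (q : ℕ) [NeZero q] (f : CuspForm (Gamma0 q) 2) ↦ (((‖KMV2000.Qtilde q 1 f‖ ^ 2 : ℝ)) : ℂ))
    (fun t ↦ t / (Real.log t) ^ 2) (1 + η)

end Summit.Parity.GeneralizedHardyLittlewood.Theorems.PrimeLevelFamEdgeIdeaDeltas.CuspTwin
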